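import Summits.ABC.ABC.Theorems.DefiniteXiDefiniteRTControlPrimeOfTakahashi
import Summits.ABC.ABC.Theorems.DefiniteXiFreyModularityIsModular
import Literature.NumberTheory.EllipticCurves.CuspFormLFunctionLevelConductorProofs
import Literature.NumberTheory.EllipticCurves.RootNumberTwistProofs
import Literature.NumberTheory.EllipticCurves.SzpiroLocalDataProofs
import Literature.NumberTheory.EllipticCurves.ShafarevichGoodReductionBadPlacesProofs
import Literature.NumberTheory.EllipticCurves.PastenHeightBoundsLemma68Proofs
import Literature.NumberTheory.EllipticCurves.IsogenyDualProofs
import Literature.NumberTheory.DiophantineGeometry.ConductorAdditiveProofs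
import Literature.NumberTheory.DiophantineGeometry.LocalReduction
import Literature.NumberTheory.EllipticCurves.CongruenceNumber
import HarnessLib

/-!
# stub-ideation k1 GEN 20 — `stub_xiDegreeComparison` (crux `SteinbergCore`, stmt-ABC-15024,
# line `Lines/p6_tamagawa_split.lean`) — typed index of the k1 decision table + the gen-20 rider CDT♮

Companion of `STUB-IDEAS-stub_xiDegreeComparison-1.md` (gen 20).  Sections:

* §A the two TARGET types verbatim: `StubHeader` (= the registered stub) and `PrimeComparison`
  (= binder `hC` of `SteinbergCorePrimeRung.primeRung_of_subs_frey`, p162616; gen 13/14 verbatim),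
  and the junction `primeComparison_of_stubHeader : StubHeader → PrimeComparison` (PROVED here).
* §B Road H = A★ (critic STUB-PLAN 03:52Z): the two consumed inputs `XiCongruenceComparison`
  (PROVED in `STUB_PLAN_…_XiMono.lean`, `StubIdeasK1G11.xiCongruenceComparison`) and `OneSidedARSFrey`
  (open; ⟸ ARS 2012 Thm 2.1(b)), verbatim, and the assembly `stubHeader_of_roadH` (PROVED in XiMono as
  `stub_xiDegreeComparison_of_oneSidedARSFrey`; sorried here only because crux-dir modules are unbuilt).
* §C Road P at prime type, its two Pareto variants by name: T♮ (k1 g19, inputs `hT + FreyModularity`)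
  and g14 (`primeComparison_kenkuFree`, inputs `hT + exists_isNewformOf (+ FreyModularity)`, `C = 1`,
  0 sorry — re-elaborated today, axioms standard).
* §D the gen-20 rider **CDT♮**: g14's ONLY use of `exists_isNewformOf` (Carayol's `N_{W₀} = N` for the
  lattice-optimal pivot) is replaced by CDT 1999 Thm 7.1.2 — the SAME named fact the tree uses for
  `FreyModularity` (`freyModularity_of_CDT_theorem_7_1_2'`) — through three small helpers PROVED here:
  H♯1 `sq_dvd_conductorNorm_of_isIsogenous` (additive reduction is a `ℚ`-isogeny invariant; port of the
  BSD cell's `ManinLocalTwoThree.sq_dvd_conductorNorm_of_isIsogenous`, Literature-only dependencies),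
  H♯2 `not_27_dvd_conductorNorm_of_isIsogenous_freyCurve`, H♯3 `conductorNorm_eq_of_isIsogenous_freyCurve_of_CDT`;
  H♯4 `primeComparison_of_takahashi_of_CDT` is g14's proof with one line swapped (sorried: statement only).
-/

set_option linter.dupNamespace false
set_option autoImplicit false

noncomputable section

open scoped Classical MatrixGroups ModularForm
open CongruenceSubgroup
open WeierstrassCurve IsDedekindDomain NumberField Rat.HeightOneSpectrum
open Literature.NumberTheory.DiophantineGeometry Literature.NumberTheory.EllipticCurves
open Literature.NumberTheory.EllipticCurves.ModularForms Literature.NumberTheory.Automorphic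
open Summit.ABC.ABC.Theses.DefiniteXi Summit.ABC.ABC.Theorems

namespace Summit.ABC.ABC.Cruxes.SteinbergCore.StubIdeasK1G20

/-! ## §A  Targets (verbatim) and the junction header ⇒ prime type -/

/-- The REGISTERED stub `stub_xiDegreeComparison` of `Lines/p6_tamagawa_split.lean`, verbatim. -/
def StubHeader : Prop :=
  ∀ ε : ℝ, 0 < ε → ∃ C : ℝ, ∀ a b : ℤ, IsCoprime a b → a * b * (a + b) ≠ 0 → ∀ (N : ℕ) [NeZero N],
    (freyCurve a b).conductorNorm ℤ = N →
    ∀ Nm : ℕ, Odd Nm → Squarefree Nm → Odd Nm.primeFactors.card → Nm ∣ N →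
    brandtXi (N / Nm) Nm (fun n => (freyCurve a b).LFunction n) ≠ 0 →
    ∃ D : ModularParametrizationData (freyCurve a b) N,
      (∀ D' : ModularParametrizationData (freyCurve a b) N, D.deg ≤ D'.deg) ∧
      ((brandtXi (N / Nm) Nm (fun n => (freyCurve a b).LFunction n) /
          (ordProj[2] (brandtXi (N / Nm) Nm (fun n => (freyCurve a b).LFunction n)) *
            ordProj[3] (brandtXi (N / Nm) Nm (fun n => (freyCurve a b).LFunction n))) : ℕ) : ℝ) ≤
        C * (N : ℝ) ^ ε * ((D.deg / (ordProj[2] D.deg * ordProj[3] D.deg) : ℕ) : ℝ) *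
          ((∏ q ∈ N.primeFactors, ((freyCurve a b).minimalDiscriminantNorm ℤ).factorization q : ℕ) : ℝ) ^ 3

/-- The PRIME TYPE of the stub = binder `hC` of `SteinbergCorePrimeRung.primeRung_of_subs_frey` (p162616)
= conclusion of `xiDegreeComparison_prime_of_facts` (p137891) = `StubIdeasK1G14.PrimeComparison`, verbatim. -/
def PrimeComparison : Prop :=
  ∀ ε : ℝ, 0 < ε → ∃ C : ℝ, ∀ a b : ℤ, IsCoprime a b → a * b * (a + b) ≠ 0 → ∀ (N : ℕ) [NeZero N],
    (freyCurve a b).conductorNorm ℤ = N → ∀ q : ℕ, q.Prime → q ≠ 2 → q ∣ N →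
    brandtXi (N / q) q (fun n => (freyCurve a b).LFunction n) ≠ 0 →
    ∃ D : ModularParametrizationData (freyCurve a b) N,
      (∀ D' : ModularParametrizationData (freyCurve a b) N, D.deg ≤ D'.deg) ∧
      ((brandtXi (N / q) q (fun n => (freyCurve a b).LFunction n) /
          (ordProj[2] (brandtXi (N / q) q (fun n => (freyCurve a b).LFunction n)) *
            ordProj[3] (brandtXi (N / q) q (fun n => (freyCurve a b).LFunction n))) : ℕ) : ℝ) ≤
        C * (N : ℝ) ^ ε * ((D.deg / (ordProj[2] D.deg * ordProj[3] D.deg) : ℕ) : ℝ) *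
          ((∏ p ∈ N.primeFactors, ((freyCurve a b).minimalDiscriminantNorm ℤ).factorization p : ℕ) : ℝ) ^ 3

/-- **Junction (PROVED): the registered header implies its prime type** — a prime `q ≠ 2` is an
admissible `Nm` (odd, squarefree, `ω(q) = 1` odd).  So whatever lands the header (Road H) also
delivers the binder `hC` of the prime-rung glue; the prime-type roads (§C, §D) matter only if the
owner re-cuts `closes` to the prime rung BEFORE the header lands. -/
theorem primeComparison_of_stubHeader (h : StubHeader) : PrimeComparison := by
  intro ε hε
  obtain ⟨C, hC⟩ := h ε hε
  refine ⟨C, fun a b hab h0 N _ hN q hq hq2 hqN hξ => ?_⟩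
  have hodd : Odd q := hq.odd_of_ne_two hq2
  have hsq : Squarefree q := hq.prime.squarefree
  have hcard : Odd q.primeFactors.card := by
    rw [hq.primeFactors, Finset.card_singleton]; exact odd_one
  exact hC a b hab h0 N hN q hodd hsq hcard hqN hξ

/-! ## §B  Road H = A★ (the registered header): the two consumed inputs, verbatim from XiMono §1c/H5♭ -/

/-- `XiCongruenceComparison` (child 1♮): `cps ξ ≤ C_ε N^ε cps(r_f)` for every newform `f` of `E_(a,b)`.
**PROVED, unconditional** — `Summit.ABC.ABC.Theorems.SteinbergCoreXi.StubIdeasK1G11.xiCongruenceComparison`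
in `STUB_PLAN_stub_xiDegreeComparison_XiMono.lean` (critic re-run 2026-09-01T03:52Z rc 0, axioms standard);
lands as helper modules Xi1–Xi10 (STUB-PLAN §1 A3).  Verbatim copy of the `def`. -/
def XiCongruenceComparison : Prop :=
  ∀ ε : ℝ, 0 < ε → ∃ C : ℝ, ∀ a b : ℤ, IsCoprime a b → a * b * (a + b) ≠ 0 → ∀ (N : ℕ) [NeZero N],
    (freyCurve a b).conductorNorm ℤ = N →
    ∀ Nm : ℕ, Odd Nm → Squarefree Nm → Odd Nm.primeFactors.card → Nm ∣ N →
    brandtXi (N / Nm) Nm (fun n => (freyCurve a b).LFunction n) ≠ 0 →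
    ∀ f : CuspForm (Gamma0 N) 2, IsNewformOf (freyCurve a b) f →
      ((brandtXi (N / Nm) Nm (fun n => (freyCurve a b).LFunction n) /
          (ordProj[2] (brandtXi (N / Nm) Nm (fun n => (freyCurve a b).LFunction n)) *
            ordProj[3] (brandtXi (N / Nm) Nm (fun n => (freyCurve a b).LFunction n))) : ℕ) : ℝ) ≤
        C * (N : ℝ) ^ ε *
          ((congruenceNumber f / (ordProj[2] (congruenceNumber f) * ordProj[3] (congruenceNumber f)) : ℕ) : ℝ)

/-- `OneSidedARSFrey` (H5♭, k1 g17 verbatim): for every Frey datum `D` at level `N = N(E_(a,b))` and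
every prime `p ≥ 5`, `ord_p r_{D.f} ≤ ord_p deg φ_D`.  OPEN in the tree; ⟸ `OneSidedARS` ⟸ ARS 2012
Thm 2.1(b) = named fact `padicValNat_congruenceNumber_eq_of_not_sq_dvd` (both implications PROVED,
XiMono helper 8). [cite: AgasheRibetStein2012, Thm. 2.1] -/
def OneSidedARSFrey : Prop :=
  ∀ (a b : ℤ), IsCoprime a b → a * b * (a + b) ≠ 0 →
    ∀ (N : ℕ) [NeZero N], (freyCurve a b).conductorNorm ℤ = N →
    ∀ (D : ModularParametrizationData (freyCurve a b) N) (p : ℕ), p.Prime → 5 ≤ p →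
      padicValNat p (congruenceNumber D.f) ≤ padicValNat p D.modularDegree

/-- **Road H assembly** — PROVED in XiMono as `StubIdeasK1G11.stub_xiDegreeComparison_of_oneSidedARSFrey`
(from `stub_of_xiCongruenceComparison_oneSidedFrey xiCongruenceComparison hF hMod`: `exists_minimal_datum`,
`cps r_{D.f} ≤ cps deg D` from H5♭, `1 ≤ T³`).  Sorried HERE only because crux-dir modules are not
built on the farm (import probe rc 75 `unbuilt`); nothing to prove for the executing seat beyond landing Xi1–Xi10. -/
theorem stubHeader_of_roadH (hX : XiCongruenceComparison) (hF : OneSidedARSFrey)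
    (hMod : FreyModularity) : StubHeader := by
  sorry

/-! ## §C  Road P (prime type only) — the two Pareto variants, by name

* T♮ (k1 g19; `STUB_IDEAS_…_1_g19_Sketch.lean`, rc 0 today, 4 sorries = H0–H3):
  `StubIdeasK1G19.xiDegreeComparison_prime_of_takahashi (hT) (hMod : FreyModularity) : PrimeComparison`,
  constant `4 (max R 0)² N^ε` from the landed radius `OfTakahashi.freyIsogenyRadiusSubpoly`; inputs ⊆ {hT} ∪ route items.
* g14 (`STUB_IDEAS_…_1_g14_Sketch.lean`, rc 0 today, **0 sorry**, axioms {propext, Classical.choice, Quot.sound}):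
  `StubIdeasK1G14.primeComparison_kenkuFree (hT) (hMod₀ : exists_isNewformOf) (hMod : FreyModularity) : PrimeComparison`
  with `C = 1`; `exists_isNewformOf` (BCDT Thm A for ALL curves) enters at ONE line: Carayol's `N_{W₀} = N`
  for the lattice-optimal pivot.  §D removes it. -/

/-- Road P, variant T♮ (g19 H4) — statement only; proof = g19 H0–H3 (2–3 prover cycles). -/
theorem primeComparison_roadT (hT : takahashi2001_thm_2_3_of_coprime) (hMod : FreyModularity) :
    PrimeComparison := by
  sorry

/-! ## §D  The gen-20 rider CDT♮: Carayol for the pivot from CDT 1999 Thm 7.1.2 (the tree's own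
`FreyModularity` input) instead of BCDT Thm A -/

/-- **H♯1 (PROVED) — `p² ∣ N(W) ⟹ p² ∣ N(W')` for `ℚ`-isogenous `W ∼ W'`** (additive reduction is an
isogeny invariant: local trichotomy + transfer of good reduction, *AEC* VII.7.2, tree
`Isogeny.hasGoodReductionAt_of_hasGoodReductionAt`, and of multiplicative reduction, tree
`Isogeny.hasMultiplicativeReductionAt_of_hasMultiplicativeReductionAt`).  Port of the BSD cell's
`ManinLocalTwoThree.sq_dvd_conductorNorm_of_isIsogenous` with Literature-only dependencies (no cross-summit
import). [cite: SilvermanAEC2009, Cor. VII.7.2] [cite: Silverman1994, IV.10.2] -/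
theorem sq_dvd_conductorNorm_of_isIsogenous {W W' : WeierstrassCurve ℚ} [W.IsElliptic] [W'.IsElliptic]
    {p : ℕ} (hp : p.Prime) (h2 : p ^ 2 ∣ W.conductorNorm ℤ) (h : IsIsogenous W W') :
    p ^ 2 ∣ W'.conductorNorm ℤ := by
  set P : Nat.Primes := ⟨p, hp⟩ with hPdef
  set v : HeightOneSpectrum ℤ := (primesEquiv (R := ℤ)).symm P with hvdef
  haveI : PerfectField (IsLocalRing.ResidueField (v.adicCompletionIntegers ℚ)) := PerfectField.ofFinite
  have hN0 : W.conductorNorm ℤ ≠ 0 := (W.conductorNorm_pos_holds).ne'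
  have hN0' : W'.conductorNorm ℤ ≠ 0 := (W'.conductorNorm_pos_holds).ne'
  have e : (W.conductorNorm ℤ).factorization p = W.conductorExponent v :=
    factorization_conductorNorm_primesEquiv_symm W P
  have e' : (W'.conductorNorm ℤ).factorization p = W'.conductorExponent v :=
    factorization_conductorNorm_primesEquiv_symm W' P
  -- `f_v(W) ≥ 2`, i.e. `W` additive at `v`
  have hf : 2 ≤ W.conductorExponent v := by
    rw [← e]; exact (hp.pow_dvd_iff_le_factorization hN0).mp h2
  have ha : W.HasAdditiveReductionAt v := (W.two_le_conductorExponent_iff_holds v).mp hf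
  -- transfer to the place of `𝓞 ℚ` over `p`, run the trichotomy for `W'` there
  set v' : HeightOneSpectrum (𝓞 ℚ) := (primesEquiv (R := 𝓞 ℚ)).symm P with hv'def
  have haW : W.HasAdditiveReductionAt v' := (W.hasAdditiveReductionAt_int_iff_ringOfIntegers P).mp ha
  obtain ⟨ψ⟩ := h.symm_of_charZero
  obtain ⟨φ⟩ := h
  have ha' : W'.HasAdditiveReductionAt v := by
    rcases hasGoodReductionAt_or_hasMultiplicativeReductionAt_or_hasAdditiveReductionAt v' W' with
      hg | hm | ha'
    · exact absurd (φ.hasGoodReductionAt_of_hasGoodReductionAt hg) haW.not_hasGoodReductionAt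
    · exact absurd (ψ.hasMultiplicativeReductionAt_of_hasMultiplicativeReductionAt hm)
        haW.not_hasMultiplicativeReductionAt
    · exact (W'.hasAdditiveReductionAt_int_iff_ringOfIntegers P).mpr ha'
  have hf' : 2 ≤ W'.conductorExponent v := (W'.two_le_conductorExponent_iff_holds v).mpr ha'
  rw [← e'] at hf'
  exact (hp.pow_dvd_iff_le_factorization hN0').mpr hf'

/-- **H♯2 (PROVED) — no curve `ℚ`-isogenous to a Frey curve has conductor divisible by `27`**
(`9 ∤ N(E_(a,b))`, tree `not_nine_dvd_conductorNorm_freyCurve`, transported by H♯1 along the dual isogeny). -/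
theorem not_27_dvd_conductorNorm_of_isIsogenous_freyCurve {a b : ℤ} (hab : IsCoprime a b)
    (h0 : a * b * (a + b) ≠ 0) {W₀ : WeierstrassCurve ℚ} [W₀.IsElliptic]
    (h : (freyCurve a b).IsIsogenous W₀) : ¬ 27 ∣ W₀.conductorNorm ℤ := by
  haveI := isElliptic_freyCurve h0
  intro h27
  have h9 : 3 ^ 2 ∣ W₀.conductorNorm ℤ := (show (3 ^ 2 : ℕ) ∣ 27 by norm_num).trans h27
  have h9' : 3 ^ 2 ∣ (freyCurve a b).conductorNorm ℤ :=
    sq_dvd_conductorNorm_of_isIsogenous Nat.prime_three h9 h.symm_of_charZero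
  exact not_nine_dvd_conductorNorm_freyCurve hab h0 (by simpa using h9')

/-- **H♯3 (PROVED) — Carayol's `N_{W₀} = N` for the curve of any datum at level `N` in a Frey isogeny
class, from CDT 1999 Thm 7.1.2**: `27 ∤ N_{W₀}` (H♯2) makes `W₀` modular at its conductor level
(`BCDT.CDT_theorem_7_1_2`), and strong multiplicity one across levels pins the level of every newform
of `W₀` (`IsNewformOf.level_eq_conductorNorm_of_exists_conductorLevel`, unconditional).  This is the line
that replaces g14's `IsNewformOf.level_eq_conductorNorm_of_exists_isNewformOf' hMod₀ D₀.isNewformOf`.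
[cite: ConradDiamondTaylor1999, Thm. 7.1.2] [cite: AtkinLehner1970, Thm. 4] -/
theorem conductorNorm_eq_of_isIsogenous_freyCurve_of_CDT (h712 : BCDT.CDT_theorem_7_1_2)
    {a b : ℤ} (hab : IsCoprime a b) (h0 : a * b * (a + b) ≠ 0) {N : ℕ} [NeZero N]
    {W₀ : WeierstrassCurve ℚ} [W₀.IsElliptic] (h : (freyCurve a b).IsIsogenous W₀)
    (D₀ : ModularParametrizationData W₀ N) : W₀.conductorNorm ℤ = N := by
  haveI : NeZero (W₀.conductorNorm ℤ) := ⟨(W₀.conductorNorm_pos_holds).ne'⟩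
  have hmod : BCDT.IsModular W₀ := h712 W₀ (not_27_dvd_conductorNorm_of_isIsogenous_freyCurve hab h0 h)
  exact (IsNewformOf.level_eq_conductorNorm_of_exists_conductorLevel hmod D₀.isNewformOf).symm

/-- **H♯4 (statement; proof = g14 `primeComparison_kenkuFree` ll. 363–434 verbatim with the Carayol line
replaced by H♯3 and `hMod := freyModularity_of_CDT_theorem_7_1_2' h712`)** — child 1 at prime type with
`C = 1` on the trust base {Takahashi 2001 Thm 2.3 (`takahashi2001_thm_2_3_of_coprime`), CDT 1999 Thm 7.1.2}:
exactly the two named facts the prime rung of `closes` ALREADY rests on (`definiteRTControlPrime_of_takahashi`;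
`freyModularity_of_CDT_theorem_7_1_2'`).  The isogeny `E_(a,b) ∼ W₀` needed by H♯3 is `DefiniteRTControlPrime.isIsogenous_of_f_eq D D₀ hf₀`
(landed, `DefiniteXiDefiniteRTControlPrime`). -/
theorem primeComparison_of_takahashi_of_CDT (hT : takahashi2001_thm_2_3_of_coprime)
    (h712 : BCDT.CDT_theorem_7_1_2) : PrimeComparison := by
  sorry

/-! ## §E  Typing checks of the named inputs (no new facts) -/

/-- `FreyModularity` from CDT 1999 Thm 7.1.2 — landed (`DefiniteXiFreyModularityIsModular`). -/
example (h712 : BCDT.CDT_theorem_7_1_2) : FreyModularity := freyModularity_of_CDT_theorem_7_1_2' h712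

/-- `FreyModularity` from BCDT Thm A — landed; g14's third hypothesis is therefore implied by its second. -/
example (h₁ : exists_isNewformOf) : FreyModularity := freyModularity_of_exists_isNewformOf' h₁

/-- The isogeny H♯3 consumes, from two data with the same newform — landed
(`Summit.ABC.ABC.Theorems.DefiniteRTControlPrime.isIsogenous_of_f_eq`, as used at g14 l. 380). -/
example {N : ℕ} [NeZero N] {W W₀ : WeierstrassCurve ℚ} [W.IsElliptic] [W₀.IsElliptic]
    (D : ModularParametrizationData W N) (D₀ : ModularParametrizationData W₀ N) (hf₀ : D₀.f = D.f) :
    W.IsIsogenous W₀ :=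
  DefiniteRTControlPrime.isIsogenous_of_f_eq D D₀ hf₀

end Summit.ABC.ABC.Cruxes.SteinbergCore.StubIdeasK1G20

end
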